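import Literature.NumberTheory.GaloisCohomology.Howard2004.DVRSettingEngineLocalInputsProofs
import Literature.NumberTheory.GaloisCohomology.Howard2004.InertTransverseDecompositionOfUnitsProofs
import Literature.NumberTheory.GaloisCohomology.Howard2004.PropagateUnramifiedProofs
import Literature.NumberTheory.GaloisCohomology.Howard2004.ResidualTateDualBijectiveProofs
import HarnessLib

/-!
# Howard 2004, §1.6 on a `DVRSetting`: the LOCAL ARITHMETIC of the residual module `T̄` at a Kolyvagin prime
# `q ∈ 𝓛^{(k)}` — the residual twins of the H159-S-LOCAL letters (trivial action, `(ℓ+1)·T̄ = 0`, Prop. 1.1.9, counts,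
# `F̄_k(q) = H¹_ur`) (proofs file)

Topic `NumberTheory/GaloisCohomology/Howard2004` (sequel to `DVRSettingEngineLocalInputsProofs` (the same letters for the LEVEL module
`T^{(j)}`), `InertTransverseDecompositionOfUnitsProofs` (Prop. 1.1.9 under `p ∤ #𝓞_K^×`), `ResidualSelmerEigenpartsProofs`
(`p · T̄ = 0`, `σ • q = q`), `PropagateUnramifiedProofs` (`F` propagated to a quotient is unramified where `F` is),
`DVRSettingLevelTrivialityProofs` §3 (`Γ_{K_q}` trivial on `T̄`, bsd-line-x10b-p1 LEAD g12), `ResidualTateDualBijectiveProofs` (`finite_residual`)).  THEOREMS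
ONLY: no definition, no named fact, no instance, no notation, no `sorry`.

SOURCE / WHY.  B. Howard, *The Heegner point Kolyvagin system*, Compositio Math. **140** (2004) = arXiv:1202.6340.  Lemma
1.6.4's Case i/ii and Lemma 1.5.3 («parity») are read on the RESIDUAL Selmer groups `H¹_{F̄(n)}(K, T̄)` (Def. 1.5.2, p. 9
L133–135: «`ρ(n)^±` the `R/𝔪`-dimension of `H¹_{F(n)}(K, T̄)^±`»); their Galois inputs at an inert prime `q` — Prop. 1.1.9
for `T̄` («`H¹(K_λ, T̄) = H¹_f ⊕ H¹_tr`», p. 6 L17–25), the counts `#H¹_tr = #T̄`, the unramified reading of the propagated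
structure — are the `T̄`-twins of the level letters.  Cell `pub/bsd-print-x9`, G87 = Thm. 1.6.1, sub-brick R3 (RES-LOCAL) of
the (GD-LINE-S) split (bsd-line-x10b-p1 LEAD g12 ruling 2026-08-29T08:05:23Z); consumers R4 (RES-CARD), R5, R6, R7.

On a `DVRSetting S` with `hy : S.SatisfiesH`, `F̄_k := (hy.h1 k).1.propagateStructure (S.t k).cond`, at `q ∈ S.levelPrimes j`
(`⊇ S.enginePrimes k` for `e_j ≤ 2e_k − 1`):
* §1 `finite_residual` · `toLocal_ρbar_apply_eq_self_of_subset_levelPrimes` (`Γ_{K_q}` trivial on `T̄ = π̄_j(T^{(j)})`) ·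
  `toLocal_sigma_smul_ρbar_apply_eq_self_of_subset_levelPrimes` (at `σ • q`) · `toLocal_twist_ρbar_apply_eq_self_of_subset_levelPrimes`
  (`Tw(T̄)`) · `residueChar_succ_smul_residual_eq_zero_of_mem_levelPrimes` (`(ℓ+1)·T̄ = 0`) · `exists_pow_p_smul_residual_eq_zero`
  / `isPrimaryTorsion_residual` (`p·T̄ = 0`).
* §2 (Prop. 1.1.9 for `T̄`, every imaginary quadratic `K` with `hu : ¬ p ∣ #𝓞_K^×`; `hd : d_K < −4 ⇒ hu`)
  **`isCompl_unramifiedSubgroup_transverseStructure_ρbar_of_mem_levelPrimes`** · `natCard_transverseStructure_ρbar_eq_of_mem_levelPrimes`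
  · `natCard_transverseStructure_ρbar_mul_eq_of_mem_levelPrimes` (`hcard` for `T̄`) · `natCard_galoisCohomology_ρbar_toLocal_eq_sq_of_mem_levelPrimes`
  · **`exists_unramified_transverse_submodules_ρbar_of_mem_levelPrimes`** (`R_k`-submodules `SVf`, `SVtr` of `H¹(K_q, T̄)` with
  underlying `H¹_ur`, `H¹_tr`, complementary, both `≃ₗ[R_k] T̄`).
* §3 `propagateStructure_cond_inr_eq_unramifiedSubgroup_of_mem_L` (`F̄_k(q) = H¹_ur(K_q, T̄)` for `q ∈ 𝓛`).
* §4 the R7 letters VERBATIM (x10b-p1-w8 g11 interface 2026-08-29T08:25:31Z): `isCompl_residualStructure_transverseStructure_of_mem_enginePrimes`,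
  **`engine_hdis`** (`∀ v ∈ S.enginePrimes k, Disjoint Lf Lt`), **`engine_hsplit`** (`∀ v ∈ S.enginePrimes k, ∀ y, ∃ a ∈ Lf, ∃ b ∈ Lt, y = a + b`).
(σ₀/`hcyc` depend on `q` only: `exists_mem_absInertia_forall_pow_inv_mul_mem_localRingClassSubgroup_of_mem_L'`; `hinf` for `T̄`
is `galoisCohomology_rhobar_toLocal_inl_eq_zero` — both reused, not restated.)

NOT HERE: the residual duality datum / H.4 / readings (R1, R2, R5), eigenlines (R6), the assembly (R7); `thm161_dvrKolyvaginBound`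
is NOT proved; no summit statement is proved; BSD is not proved by any of this.  Seat `bsd-line-x9-p1-w3` g15.

References: [Howard2004HeegnerKolyvagin] Prop. 1.1.9, Def. 1.1.3, Def. 1.2.2, H.1, Def. 1.5.2, §1.6 (arXiv:1202.6340 p. 5 L93–99,
p. 6 L17–25, L57–125, p. 7 L59, p. 9 L133–135, p. 11 L33–44); [MazurRubin2004] Lemma 1.1.5; [GrossLMS1991] §3.
-/

set_option autoImplicit false

noncomputable section

open Function NumberField IsDedekindDomain IsDedekindDomain.HeightOneSpectrum Field
open scoped NumberField

namespace Literature.NumberTheory.GaloisCohomology.Howard2004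

open Literature.NumberTheory.GaloisRepresentations
open Literature.NumberTheory.GaloisRepresentations.DiscreteGaloisModule
open Literature.NumberTheory.EllipticCurves

section DVR

variable {p : ℕ} [Fact p.Prime] {K : Type} [Field K] [NumberField K]
  {R : Type} [CommRing R] [IsDomain R] [IsDiscreteValuationRing R] [Algebra ℤ_[p] R]
  {N : ℕ → Type} [∀ k, AddCommGroup (N k)] [∀ k, TopologicalSpace (N k)]
  [∀ k, DiscreteTopology (N k)] [∀ k, Module R (N k)]
  {Rk : ℕ → Type} [∀ k, CommRing (Rk k)] [∀ k, IsLocalRing (Rk k)] [∀ k, TopologicalSpace (Rk k)]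
  [∀ k, DiscreteTopology (Rk k)] [∀ k, Algebra ℤ_[p] (Rk k)] [∀ k, Algebra R (Rk k)]
  [∀ k, Module (Rk k) (N k)] [∀ k, IsScalarTower R (Rk k) (N k)]
  {Nbar : Type} [AddCommGroup Nbar] [TopologicalSpace Nbar] [DiscreteTopology Nbar]
  [∀ k, Module (Rk k) Nbar]
  {Nq : ℕ → Finset (HeightOneSpectrum (𝓞 K)) → Type} [∀ k n, AddCommGroup (Nq k n)]
  [∀ k n, TopologicalSpace (Nq k n)] [∀ k n, DiscreteTopology (Nq k n)]
  [∀ k n, Module (Rk k) (Nq k n)] [∀ k n, Module R (Nq k n)]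
  [∀ k n, IsScalarTower R (Rk k) (Nq k n)]

namespace DVRSetting

/-! ## §1 `T̄` at `q ∈ 𝓛^{(j)}`: trivial local action at `σ • q` and on `Tw(T̄)`, `(ℓ + 1) · T̄ = 0`, `p · T̄ = 0` -/

/-- `htriv'` for `T̄`: `Γ_{K_{σq}}` is trivial on `T̄` for `q ∈ n ⊆ 𝓛^{(j)}` (`σ • q = q`).
[cite: Howard2004HeegnerKolyvagin, H.1 and §1.6 (arXiv:1202.6340 p. 7 L59, p. 11 L33–38)] -/
theorem toLocal_sigma_smul_ρbar_apply_eq_self_of_subset_levelPrimes (S : DVRSetting p K R N Rk Nbar Nq)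
    (hy : S.SatisfiesH) {j : ℕ} {n : Finset (HeightOneSpectrum (𝓞 K))} (hn : ↑n ⊆ S.levelPrimes j)
    {q : HeightOneSpectrum (𝓞 K)} (hq : q ∈ n) (σ : absoluteGaloisGroup ((S.cd.σ • q).adicCompletion K))
    (x : Nbar) : GaloisRep.toLocal (S.cd.σ • q) S.ρbar σ x = x := by
  have hσq : S.cd.σ • q ∈ n := by rwa [S.sigma_smul_eq_self_of_mem_L hy (hn hq).1]
  exact S.toLocal_ρbar_apply_eq_self_of_subset_levelPrimes hy hn hσq σ x

/-- `htrivTw` for `T̄`: `Tw(T̄)|_{Γ_{K_q}}` is trivial for `q ∈ n ⊆ 𝓛^{(j)}`.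
[cite: Howard2004HeegnerKolyvagin, §1.3 and §1.6 (arXiv:1202.6340 p. 7 L33–48, p. 11 L33–38)] -/
theorem toLocal_twist_ρbar_apply_eq_self_of_subset_levelPrimes (S : DVRSetting p K R N Rk Nbar Nq)
    (hy : S.SatisfiesH) {j : ℕ} {n : Finset (HeightOneSpectrum (𝓞 K))} (hn : ↑n ⊆ S.levelPrimes j)
    {q : HeightOneSpectrum (𝓞 K)} (hq : q ∈ n) (g : absoluteGaloisGroup (q.adicCompletion K)) (x : Nbar) :
    GaloisRep.toLocal q (S.cd.twist S.ρbar) g x = x :=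
  S.cd.toLocal_twist_apply_eq_self S.ρbar q
    (fun σ y => S.toLocal_sigma_smul_ρbar_apply_eq_self_of_subset_levelPrimes hy hn hq σ y) g x

/-- **`(ℓ + 1) · T̄ = 0` for `q ∈ 𝓛^{(j)}`** (any `j`: `ℓ + 1 ∈ p^{e_j} R ⊆ 𝔪`, and `𝔪 · T̄ = 0`).
[cite: Howard2004HeegnerKolyvagin, Def. 1.2.1, H.1 (arXiv:1202.6340 p. 6 L63–68, p. 7 L59)] -/
theorem residueChar_succ_smul_residual_eq_zero_of_mem_levelPrimes (S : DVRSetting p K R N Rk Nbar Nq)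
    (hy : S.SatisfiesH) {j : ℕ} {q : HeightOneSpectrum (𝓞 K)} (hq : q ∈ S.levelPrimes j) (x : Nbar) :
    (residueChar q + 1) • x = 0 := by
  obtain ⟨y, rfl⟩ := (hy.h1 j).1.surjective x
  rw [← map_nsmul, S.residueChar_succ_smul_eq_zero_of_mem_levelPrimes hy hq y, map_zero]

/-- `T̄` is `p`-primary (`p · T̄ = 0`): the binder `hp` for `T̄`. [cite: Howard2004HeegnerKolyvagin, H.1 (arXiv:1202.6340 p. 7 L59)] -/
theorem exists_pow_p_smul_residual_eq_zero (S : DVRSetting p K R N Rk Nbar Nq) (hy : S.SatisfiesH) (x : Nbar) :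
    ∃ m : ℕ, p ^ m • x = 0 :=
  ⟨1, by rw [pow_one]; exact S.p_nsmul_residual_eq_zero hy x⟩

/-- `T̄` is `p`-primary torsion (tree predicate). [cite: Howard2004HeegnerKolyvagin, H.1 (arXiv:1202.6340 p. 7 L59)] -/
theorem isPrimaryTorsion_residual (S : DVRSetting p K R N Rk Nbar Nq) (hy : S.SatisfiesH) :
    IsPrimaryTorsion p Nbar :=
  fun x => S.exists_pow_p_smul_residual_eq_zero hy x

/-! ## §2 Prop. 1.1.9 for `T̄` at `q ∈ 𝓛^{(j)}` (every imaginary quadratic `K` with `p ∤ #𝓞_K^×`) -/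

/-- **Howard Prop. 1.1.9 for the RESIDUAL module: `H¹(K_q, T̄) = H¹_f ⊕ H¹_tr`** for `q ∈ 𝓛^{(j)}` and every
imaginary quadratic `K` with `p ∤ #𝓞_K^×` (Def. 1.5.2's residual Selmer groups are read against this splitting).
[cite: Howard2004HeegnerKolyvagin, Prop. 1.1.9, Def. 1.5.2 (arXiv:1202.6340 p. 6 L17–25, p. 9 L133–135)] -/
theorem isCompl_unramifiedSubgroup_transverseStructure_ρbar_of_mem_levelPrimes (S : DVRSetting p K R N Rk Nbar Nq)
    (hy : S.SatisfiesH) (hu : ¬ p ∣ Nat.card (𝓞 K)ˣ) {j : ℕ} {q : HeightOneSpectrum (𝓞 K)}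
    (hq : q ∈ S.levelPrimes j) :
    IsCompl (unramifiedSubgroup (GaloisRep.toLocal q S.ρbar) 1)
      (transverseStructure p S.ρbar S.jbar (Sum.inr q)) := by
  haveI : Finite Nbar := S.finite_residual hy
  have hn : ↑({q} : Finset (HeightOneSpectrum (𝓞 K))) ⊆ S.levelPrimes j := by
    rw [Finset.coe_singleton, Set.singleton_subset_iff]; exact hq
  exact isCompl_unramifiedSubgroup_transverseStructure_of_isDegreeTwo_of_not_dvd_card_units p hy.imagQuad hu S.ρbar
    S.jbar (S.isDegreeTwo_of_mem_L hy hq.1)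
    (fun g x => S.toLocal_ρbar_apply_eq_self_of_subset_levelPrimes hy hn (Finset.mem_singleton_self q) g x)
    (S.exists_pow_p_smul_residual_eq_zero hy) (S.residueChar_succ_smul_residual_eq_zero_of_mem_levelPrimes hy hq)

/-- The same under the old standing hypothesis `d_K < −4`. [cite: Howard2004HeegnerKolyvagin, Prop. 1.1.9 (arXiv:1202.6340 p. 6 L17–25)] -/
theorem isCompl_unramifiedSubgroup_transverseStructure_ρbar_of_mem_levelPrimes_of_discr_lt
    (S : DVRSetting p K R N Rk Nbar Nq) (hy : S.SatisfiesH) (hd : NumberField.discr K < -4) {j : ℕ}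
    {q : HeightOneSpectrum (𝓞 K)} (hq : q ∈ S.levelPrimes j) :
    IsCompl (unramifiedSubgroup (GaloisRep.toLocal q S.ρbar) 1)
      (transverseStructure p S.ρbar S.jbar (Sum.inr q)) :=
  S.isCompl_unramifiedSubgroup_transverseStructure_ρbar_of_mem_levelPrimes hy (Howard2004.not_dvd_card_units_of_discr_lt hy.imagQuad hd Fact.out hy.p_odd) hq

/-- **`#H¹(K_q, T̄) = (#T̄)²`** for `q ∈ 𝓛^{(j)}` (trivial action, `(ℓ+1)·T̄ = 0`).
[cite: Howard2004HeegnerKolyvagin, Prop. 1.1.7 / 1.1.9 (arXiv:1202.6340 p. 5 L129–141, p. 6 L17–25)] -/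
theorem natCard_galoisCohomology_ρbar_toLocal_eq_sq_of_mem_levelPrimes (S : DVRSetting p K R N Rk Nbar Nq)
    (hy : S.SatisfiesH) {j : ℕ} {q : HeightOneSpectrum (𝓞 K)} (hq : q ∈ S.levelPrimes j) :
    Nat.card (galoisCohomology (GaloisRep.toLocal q S.ρbar) 1) = Nat.card Nbar ^ 2 := by
  haveI : Finite Nbar := S.finite_residual hy
  have hn : ↑({q} : Finset (HeightOneSpectrum (𝓞 K))) ⊆ S.levelPrimes j := by
    rw [Finset.coe_singleton, Set.singleton_subset_iff]; exact hq
  exact natCard_galoisCohomology_toLocal_one_eq_sq_of_succ_smul hy.imagQuad.1 S.ρbar (prime_residueChar q)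
    (isPrime_span_residueChar_of_isDegreeTwo hy.imagQuad.1 (S.isDegreeTwo_of_mem_L hy hq.1))
    (natCast_residueChar_mem_asIdeal q)
    (fun g x => S.toLocal_ρbar_apply_eq_self_of_subset_levelPrimes hy hn (Finset.mem_singleton_self q) g x)
    (S.residueChar_succ_smul_residual_eq_zero_of_mem_levelPrimes hy hq)

/-- **`#H¹_tr(K_q, T̄) = #T̄`** for `q ∈ 𝓛^{(j)}`, `p ∤ #𝓞_K^×`. [cite: Howard2004HeegnerKolyvagin, Prop. 1.1.9 (arXiv:1202.6340 p. 6 L17–25)] -/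
theorem natCard_transverseStructure_ρbar_eq_of_mem_levelPrimes (S : DVRSetting p K R N Rk Nbar Nq)
    (hy : S.SatisfiesH) (hu : ¬ p ∣ Nat.card (𝓞 K)ˣ) {j : ℕ} {q : HeightOneSpectrum (𝓞 K)}
    (hq : q ∈ S.levelPrimes j) :
    Nat.card (transverseStructure p S.ρbar S.jbar (Sum.inr q)) = Nat.card Nbar := by
  haveI : Finite Nbar := S.finite_residual hy
  have hn : ↑({q} : Finset (HeightOneSpectrum (𝓞 K))) ⊆ S.levelPrimes j := by
    rw [Finset.coe_singleton, Set.singleton_subset_iff]; exact hq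
  exact natCard_transverseCondition_eq_of_not_dvd_card_units p hy.imagQuad hu S.ρbar S.jbar (prime_residueChar q)
    (isPrime_span_residueChar_of_isDegreeTwo hy.imagQuad.1 (S.isDegreeTwo_of_mem_L hy hq.1))
    (natCast_residueChar_mem_asIdeal q)
    (fun g x => S.toLocal_ρbar_apply_eq_self_of_subset_levelPrimes hy hn (Finset.mem_singleton_self q) g x)
    (S.exists_pow_p_smul_residual_eq_zero hy) (S.residueChar_succ_smul_residual_eq_zero_of_mem_levelPrimes hy hq)

/-- **`#H¹_tr(K_q, T̄) · #H¹_tr(K_{σq}, T̄) = #H¹(K_q, T̄)`** for `q ∈ 𝓛^{(j)}`, `p ∤ #𝓞_K^×` — the `hcard` of the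
isotropy-count criterion for `T̄` (R4). [cite: Howard2004HeegnerKolyvagin, Prop. 1.1.9 and Lemma 1.5.6 (arXiv:1202.6340 p. 6 L17–25, p. 10 L86–88)] -/
theorem natCard_transverseStructure_ρbar_mul_eq_of_mem_levelPrimes (S : DVRSetting p K R N Rk Nbar Nq)
    (hy : S.SatisfiesH) (hu : ¬ p ∣ Nat.card (𝓞 K)ˣ) {j : ℕ} {q : HeightOneSpectrum (𝓞 K)}
    (hq : q ∈ S.levelPrimes j) :
    Nat.card (transverseStructure p S.ρbar S.jbar (Sum.inr q)) *
        Nat.card (transverseStructure p S.ρbar S.jbar (Sum.inr (S.cd.σ • q))) =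
      Nat.card (galoisCohomology (S.ρbar.toLocal (Sum.inr q)) 1) := by
  haveI : Finite Nbar := S.finite_residual hy
  have hn : ↑({q} : Finset (HeightOneSpectrum (𝓞 K))) ⊆ S.levelPrimes j := by
    rw [Finset.coe_singleton, Set.singleton_subset_iff]; exact hq
  exact natCard_transverseStructure_mul_eq_of_isDegreeTwo_of_not_dvd_card_units p hy.imagQuad hu S.ρbar S.jbar
    (S.isDegreeTwo_of_mem_L hy hq.1) (S.residueChar_sigma_smul_of_mem_L hy hq.1)
    (fun g x => S.toLocal_ρbar_apply_eq_self_of_subset_levelPrimes hy hn (Finset.mem_singleton_self q) g x)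
    (fun g x => S.toLocal_sigma_smul_ρbar_apply_eq_self_of_subset_levelPrimes hy hn (Finset.mem_singleton_self q) g x)
    (S.exists_pow_p_smul_residual_eq_zero hy) (S.residueChar_succ_smul_residual_eq_zero_of_mem_levelPrimes hy hq)

/-- **Prop. 1.1.9 `R_k`-linearly for `T̄`**: `R_k`-submodules `SVf`, `SVtr` of `H¹(K_q, T̄)` (Howard's scalar structure through
`S.isScalarLinear_rhobar hy k`) with underlying subgroups `H¹_ur`, `H¹_tr`, complementary, and both `≃ₗ[R_k] T̄` — the `hc`,
`ef`, `etr` of the Lagrangian transfer / the readings at the residual level (`q ∈ 𝓛^{(j)}`, `p ∤ #𝓞_K^×`).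
[cite: Howard2004HeegnerKolyvagin, Prop. 1.1.9, §1.5, Def. 1.5.2 (arXiv:1202.6340 p. 6 L17–25, p. 9 L105–108, L133–135)] -/
theorem exists_unramified_transverse_submodules_ρbar_of_mem_levelPrimes (S : DVRSetting p K R N Rk Nbar Nq)
    (hy : S.SatisfiesH) (hu : ¬ p ∣ Nat.card (𝓞 K)ˣ) (k : ℕ) {j : ℕ} {q : HeightOneSpectrum (𝓞 K)}
    (hq : q ∈ S.levelPrimes j) :
    letI := galoisCohomology.moduleH1 (S.ρbar.toLocal (Sum.inr q))
      ((S.isScalarLinear_rhobar hy k).restrictField (Place.Completion (Sum.inr q)))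
    ∃ SVf SVtr : Submodule (Rk k) (galoisCohomology (S.ρbar.toLocal (Sum.inr q)) 1),
      SVf.toAddSubgroup = unramifiedSubgroup (GaloisRep.toLocal q S.ρbar) 1 ∧
      SVtr.toAddSubgroup = transverseStructure p S.ρbar S.jbar (Sum.inr q) ∧
      IsCompl SVf SVtr ∧ Nonempty (↥SVf ≃ₗ[Rk k] Nbar) ∧ Nonempty (↥SVtr ≃ₗ[Rk k] Nbar) := by
  haveI : Finite Nbar := S.finite_residual hy
  have hn : ↑({q} : Finset (HeightOneSpectrum (𝓞 K))) ⊆ S.levelPrimes j := by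
    rw [Finset.coe_singleton, Set.singleton_subset_iff]; exact hq
  have hρv : DiscreteGaloisModule.IsScalarLinear (Rk k) (GaloisRep.toLocal q S.ρbar) :=
    (S.isScalarLinear_rhobar hy k).restrictField (Place.Completion (Sum.inr q))
  obtain ⟨Vtr, hVtr, hc, ⟨ef⟩, ⟨etr⟩⟩ :=
    exists_transverse_submodule_isCompl_linearEquiv_of_isDegreeTwo_of_not_dvd_card_units p hy.imagQuad hu S.ρbar
      S.jbar (S.isDegreeTwo_of_mem_L hy hq.1) hρv
      (fun g x => S.toLocal_ρbar_apply_eq_self_of_subset_levelPrimes hy hn (Finset.mem_singleton_self q) g x)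
      (S.exists_pow_p_smul_residual_eq_zero hy) (S.residueChar_succ_smul_residual_eq_zero_of_mem_levelPrimes hy hq)
  exact ⟨DiscreteGaloisModule.unramifiedSubmodule hρv, Vtr, DiscreteGaloisModule.toAddSubgroup_unramifiedSubmodule hρv,
    hVtr, hc, ⟨ef⟩, ⟨etr⟩⟩

/-! ## §3 The propagated structure `F̄_k` is unramified at the primes of `𝓛` -/

/-- **`F̄_k(q) = H¹_ur(K_q, T̄)` for `q ∈ 𝓛`**: `F` is unramified at `q` (`𝓛 ∩ Σ(F) = ∅`), `T^{(k)}` is unramified at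
`q ∈ 𝓛 ⊆ 𝓛₀(T)`, and a condition propagated along the surjection `π̄_k` sends `H¹_ur` onto `H¹_ur` — the binder `h𝓕q`
at the residual level. [cite: Howard2004HeegnerKolyvagin, Def. 1.1.3, Def. 1.1.10, §1.2 (arXiv:1202.6340 p. 5 L93–99, p. 6 L10–24, L57–60)] [cite: MazurRubin2004, Lemma 1.1.5] -/
theorem propagateStructure_cond_inr_eq_unramifiedSubgroup_of_mem_L (S : DVRSetting p K R N Rk Nbar Nq)
    (hy : S.SatisfiesH) (k : ℕ) {q : HeightOneSpectrum (𝓞 K)} (hq : q ∈ S.L) :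
    (hy.h1 k).1.propagateStructure (S.t k).cond (Sum.inr q) =
      (unramifiedSubgroup (GaloisRep.toLocal q S.ρbar) 1 :) := by
  haveI : Finite (N k) := S.finite_level hy k
  exact (hy.h1 k).1.propagateStructure_inr_eq_unramifiedSubgroup (S.t k).cond
    (S.cond_inr_eq_unramifiedSubgroup_of_mem_L hy k hq) (S.isUnramifiedAt_of_mem_L hy hq k)

/-! ## §4 The letters of the (GD-LINE-S) assembly R7, verbatim: `IsCompl F̄_k(v) 𝒯̄(v)`, `hdis`, `hsplit` at `v ∈ 𝓛^{(2k−1)}` -/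

/-- **`F̄_k(v) ⊕ H¹_tr(K_v, T̄) = H¹(K_v, T̄)` at every engine prime `v ∈ 𝓛^{(2k−1)}`** (`p ∤ #𝓞_K^×`): Prop. 1.1.9 for `T̄`
with the propagated structure's condition `F̄_k(v) = H¹_ur` (§3) in place of `H¹_ur` — the complementarity the (GD-LINE-S)
assembly reads at the residual level. [cite: Howard2004HeegnerKolyvagin, Prop. 1.1.9, Def. 1.5.2, Lemma 1.6.4 (arXiv:1202.6340 p. 6 L17–25, p. 9 L133–135, p. 12 L1–27)] -/
theorem isCompl_residualStructure_transverseStructure_of_mem_enginePrimes (S : DVRSetting p K R N Rk Nbar Nq)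
    (hy : S.SatisfiesH) (hu : ¬ p ∣ Nat.card (𝓞 K)ˣ) (k : ℕ) :
    ∀ v, v ∈ S.enginePrimes k →
      IsCompl ((hy.h1 k).1.propagateStructure (S.t k).cond (Sum.inr v))
        (transverseStructure p S.ρbar S.jbar (Sum.inr v)) := by
  intro v hv
  rw [S.propagateStructure_cond_inr_eq_unramifiedSubgroup_of_mem_L hy k hv.1]
  exact S.isCompl_unramifiedSubgroup_transverseStructure_ρbar_of_mem_levelPrimes hy hu
    (S.enginePrimes_subset_levelPrimes hy k hv)

/-- **`hdis`** of the (GD-LINE-S) assembly: `F̄_k(v) ∩ H¹_tr(K_v, T̄) = 0` at every `v ∈ 𝓛^{(2k−1)}` (`p ∤ #𝓞_K^×`).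
[cite: Howard2004HeegnerKolyvagin, Prop. 1.1.9 (arXiv:1202.6340 p. 6 L17–25)] -/
theorem engine_hdis (S : DVRSetting p K R N Rk Nbar Nq) (hy : S.SatisfiesH) (hu : ¬ p ∣ Nat.card (𝓞 K)ˣ) (k : ℕ) :
    ∀ v, v ∈ S.enginePrimes k →
      Disjoint ((hy.h1 k).1.propagateStructure (S.t k).cond (Sum.inr v))
        (transverseStructure p S.ρbar S.jbar (Sum.inr v)) :=
  fun v hv => (S.isCompl_residualStructure_transverseStructure_of_mem_enginePrimes hy hu k v hv).disjoint

/-- **`hsplit`** of the (GD-LINE-S) assembly: every class of `H¹(K_v, T̄)` is `a + b` with `a ∈ F̄_k(v)`, `b ∈ H¹_tr(K_v, T̄)`,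
at every `v ∈ 𝓛^{(2k−1)}` (`p ∤ #𝓞_K^×`). [cite: Howard2004HeegnerKolyvagin, Prop. 1.1.9 (arXiv:1202.6340 p. 6 L17–25)] -/
theorem engine_hsplit (S : DVRSetting p K R N Rk Nbar Nq) (hy : S.SatisfiesH) (hu : ¬ p ∣ Nat.card (𝓞 K)ˣ) (k : ℕ) :
    ∀ v, v ∈ S.enginePrimes k → ∀ y : galoisCohomology (S.ρbar.toLocal (Sum.inr v)) 1,
      ∃ a ∈ (hy.h1 k).1.propagateStructure (S.t k).cond (Sum.inr v),
        ∃ b ∈ transverseStructure p S.ρbar S.jbar (Sum.inr v), y = a + b := by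
  intro v hv y
  have h := (S.isCompl_residualStructure_transverseStructure_of_mem_enginePrimes hy hu k v hv).sup_eq_top
  have hy' : y ∈ (hy.h1 k).1.propagateStructure (S.t k).cond (Sum.inr v) ⊔ transverseStructure p S.ρbar S.jbar (Sum.inr v) := by
    rw [h]; exact AddSubgroup.mem_top y
  obtain ⟨a, ha, b, hb, hab⟩ := AddSubgroup.mem_sup.mp hy'
  exact ⟨a, ha, b, hb, hab.symm⟩

/-- The same three letters under the old standing hypothesis `d_K < −4`. [cite: Howard2004HeegnerKolyvagin, Prop. 1.1.9 (arXiv:1202.6340 p. 6 L17–25)] -/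
theorem engine_hdis_of_discr_lt (S : DVRSetting p K R N Rk Nbar Nq) (hy : S.SatisfiesH) (hd : NumberField.discr K < -4)
    (k : ℕ) :
    ∀ v, v ∈ S.enginePrimes k →
      Disjoint ((hy.h1 k).1.propagateStructure (S.t k).cond (Sum.inr v))
        (transverseStructure p S.ρbar S.jbar (Sum.inr v)) :=
  S.engine_hdis hy (Howard2004.not_dvd_card_units_of_discr_lt hy.imagQuad hd Fact.out hy.p_odd) k

end DVRSetting

end DVR

end Literature.NumberTheory.GaloisCohomology.Howard2004

end
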